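import Summits.BirchSwinnertonDyer.BirchSwinnertonDyer.Theorems.ErratumRoadFiveNonSurjCornerTwinMuAnUnitValue
import Summits.BirchSwinnertonDyer.BirchSwinnertonDyer.Theorems.ErratumRoadFiveNonSurjCornerTamagawaCarriers
import Literature.NumberTheory.EllipticCurves.LeadingTermPPartProofs
import Literature.NumberTheory.EllipticCurves.ComplexMultiplicationBurungaleFlachProofs
import Literature.NumberTheory.EllipticCurves.RegulatorProofs
import Literature.NumberTheory.EllipticCurves.Rank1Residual.PrintShape
import HarnessLib

/-!
# Route `ErratumRoadFive` (rung K2), crux child `NonSurjCornerTwinMuAn` (item stmt-BirchSwinnertonDyer-19948, parent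
# 19065 `NonSurjCorner`): the NON-split stub `stub_twinMuAn_nonsplit` FROM BSD-INVARIANT DATA — on an X11a leaf twin with
# no split multiplicative place, the unit-value certificate `‖ϖ·[0]⁺_f‖_p = 1` IS `p ∤ #Ш(Wd)_an` (cell `bsd-stepL`, seat
# `bsd-stepL-corner5-p2` g6, WIDTH-LEVER lane B; `--supports stmt-BirchSwinnertonDyer-19948 --as helper`)

WHAT. Corner-p1 g7's `…TwinMuAnUnitValue` proves the registered non-split stub of 19948 on the UNIT-VALUE locus
`‖ϖ·[0]⁺_f‖_p = 1` (the constant term of the MTT function with `a = −1` is `2ϖ·[0]⁺_f`). This file reads that locus in the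
currency of the BSD invariants that the tables carry: at analytic rank `0` (class X11a), `L(Wd,1) = [0]⁺_f·Ω⁺_f`
(`IsNewformOf.entireLFunction_one_eq`) and `Ω⁺_f = ϖ·Ω(Wd)`, so by the DEFINITION of the analytic order of Ш
(`shaAn Wd = L(Wd,1)·#tors²/(Ω·∏c·Reg)`, `Reg = 1` at rank `0` — GZK for `rank = r_an`) one has the exact identity
**`ϖ·[0]⁺_f = #Ш(Wd)_an · ∏_ℓ c_ℓ(Wd) / #Wd(ℚ)_tors²`** (§1). On a corner twin `p ∤ #tors` (`E[p]` irreducible, tree lemma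
`padicValNat_torsionOrder_eq_zero_of_irreducible`) and `p ∣ ∏c ⟺ Wd has a split multiplicative place` (g4's
`NonSurjTwin.dvd_tamagawaProduct_iff_exists_split`); hence on the twins WITHOUT a split multiplicative place (in particular
non-split at `p`: the `a = −1` branch) **the certificate is exactly `p ∤ #Ш(Wd)_an`** (§2), and the stub follows there from
g7's `exists_norm_coeff_eq_one_of_neg_one_of_padicValRat_eq_zero` (§3). The cell's CERT-TWINMUAN-5 values
«L(E^d,1)/Ω = 8, 32, 72, 6, 6, 6» are `#Ш_an·∏c/#tors²` read this way.

* §1 `MuAnUnit.varpi_mul_ratPlusSymbol_eq` — rank-`0` identity `ϖ·[0]⁺_f = q·∏c/#tors²` for `shaAn Wd = q`, modulo GZK.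
* §2 `MuAnUnit.padicValRat_varpi_mul_ratPlusSymbol_eq_zero` — `ord_p(ϖ·[0]⁺_f) = 0` from `ord_p q = 0`, no split place,
  `E[p]` irreducible (`p ≥ 5`).
* §3 **`Theorems.nonSurjCornerTwinMuAn_nonsplit_of_shaAn_unit_of_forall_not_split`** — the registered stub text verbatim plus:
  GZK by name (`hGZK`, conjunct 4 of `KatoTwinFactsFiveAn`), `shaAn Wd = q` with `ord_p q = 0` and `q ≠ 0`, and «no split
  multiplicative place».

HONEST FRAMING: theorems only (no definition, no named fact, no `sorry`); CONDITIONAL on GZK (published) and the displayed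
per-twin data; nothing is asserted about any curve; 19948 does NOT close; BSD is advanced for no class (T7).
References: [Miller2011LMS] §1 (`#Ш_an`); [MazurTateTeitelbaum1986Invent] §I.10; [GreenbergLNM1716] §4; [SilvermanATAEC1994] Cor. IV.9.2 (d);
tree: `…TwinMuAnUnitValue` (p≈g7), `…TamagawaCarriers` (p557941), `LeadingTermPPartProofs`, `Disegni2020/PAdicBSDRankLeOneDerived`
(the same rank-0 bookkeeping), `Rank1Residual/PrintShape` (`padicValNat_torsionOrder_eq_zero_of_irreducible`).
-/

set_option autoImplicit false
set_option linter.dupNamespace false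

noncomputable section

open scoped Classical NumberField MatrixGroups ModularForm

namespace Summit.BirchSwinnertonDyer.Rank1Residual.X11b.MuAnUnit

open CongruenceSubgroup WeierstrassCurve Literature.NumberTheory.EllipticCurves
  Literature.NumberTheory.EllipticCurves.ModularForms Literature.NumberTheory.EllipticCurves.Rank1Residual
  Summit.BirchSwinnertonDyer.Rank1Residual IsDedekindDomain

variable {N : ℕ} [NeZero N] {f : CuspForm (Gamma0 N) 2} {p : ℕ} [Fact p.Prime]
  {Wd : WeierstrassCurve ℚ} [Wd.IsElliptic] [Wd.IsGloballyMinimal]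

/-! ### §1 The rank-0 identity `ϖ·[0]⁺_f = #Ш_an·∏c/#tors²` -/

omit [Wd.IsGloballyMinimal] in
/-- **At analytic rank `0`: `ϖ·[0]⁺_f = #Ш(Wd)_an · ∏c / #tors²`** (as rationals), for `shaAn Wd = q`, the newform `f` of `Wd`
and the period ratio `ϖ` (`ϖ·Ω(Wd) = Ω⁺_f`); GZK (`hGZK`) supplies `rank = 0`, hence `Reg = 1`. The bookkeeping of
`Disegni2020/PAdicBSDRankLeOneDerived`. [cite: Miller2011LMS, §1 (arXiv:1010.2431 p. 3)] -/
theorem varpi_mul_ratPlusSymbol_eq (hGZK : rank_eq_analyticRank_of_analyticRank_le_one) (h0 : Wd.analyticRank = 0)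
    (hf : IsNewformOf Wd f) {ϖ : ℚ} (hϖ : (ϖ : ℝ) * Wd.realPeriodRat = plusPeriod f) {q : ℚ} (hq : shaAn Wd = (q : ℂ)) :
    ϖ * ratPlusSymbol f 0 = q * Wd.tamagawaProduct / (Wd.torsionOrder : ℚ) ^ 2 := by
  obtain ⟨hrank, -⟩ := hGZK Wd (by omega)
  have hmw : Wd.mordellWeilRank = 0 := hrank.trans h0
  have hReg : Wd.regulator = 1 := Wd.regulator_eq_one_of_rank_zero hmw
  have hLead : Wd.leadingLCoeff = Wd.entireLFunction 1 := Wd.leadingLCoeff_eq_of_analyticRank_eq_zero h0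
  have hΩ : (Wd.realPeriodRat : ℂ) ≠ 0 := by exact_mod_cast Wd.realPeriodRat_pos_holds.ne'
  have hc : (Wd.tamagawaProduct : ℂ) ≠ 0 := by exact_mod_cast (Wd.tamagawaProduct_pos').ne'
  have ht : (Wd.torsionOrder : ℂ) ≠ 0 := by exact_mod_cast (Wd.torsionOrder_pos_holds).ne'
  have hs : shaAn Wd = ((ratPlusSymbol f 0 * ϖ * (Wd.torsionOrder : ℚ) ^ 2 / Wd.tamagawaProduct : ℚ) : ℂ) := by
    rw [shaAn_def, hLead, hf.entireLFunction_one_eq, hReg, ← hϖ]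
    push_cast
    field_simp
  rw [hq] at hs
  have hs' : q = ratPlusSymbol f 0 * ϖ * (Wd.torsionOrder : ℚ) ^ 2 / Wd.tamagawaProduct := by exact_mod_cast hs
  have htq : (Wd.torsionOrder : ℚ) ≠ 0 := by exact_mod_cast (Wd.torsionOrder_pos_holds).ne'
  have hcq : (Wd.tamagawaProduct : ℚ) ≠ 0 := by exact_mod_cast (Wd.tamagawaProduct_pos').ne'
  rw [hs']; field_simp

/-! ### §2 Its `p`-adic valuation on a corner twin without split places -/

/-- **`ord_p(ϖ·[0]⁺_f) = 0` on an X11a leaf twin with `ρ̄` not onto, `p ≥ 5`, NO split multiplicative place and `p ∤ #Ш_an`**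
(`shaAn Wd = q`, `q ≠ 0`, `ord_p q = 0`): `∏c` is prime to `p` (g4: carriers = split places) and so is `#tors` (`E[p]` irreducible).
[cite: SilvermanATAEC1994, Cor. IV.9.2 (d)] [cite: Miller2011LMS, §1] -/
theorem padicValRat_varpi_mul_ratPlusSymbol_eq_zero (hGZK : rank_eq_analyticRank_of_analyticRank_le_one)
    (hXa : ClassX11a Wd p) (hns : ¬ Surj Wd p) (hp5 : 5 ≤ p)
    (hnosplit : ∀ v : HeightOneSpectrum (𝓞 ℚ), ¬ Wd.HasSplitMultiplicativeReductionAt v)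
    (hf : IsNewformOf Wd f) {ϖ : ℚ} (hϖ : (ϖ : ℝ) * Wd.realPeriodRat = plusPeriod f)
    {q : ℚ} (hq : shaAn Wd = (q : ℂ)) (hq0 : q ≠ 0) (hv : padicValRat p q = 0) :
    ϖ * ratPlusSymbol f 0 ≠ 0 ∧ padicValRat p (ϖ * ratPlusSymbol f 0) = 0 := by
  have htq : (Wd.torsionOrder : ℚ) ≠ 0 := by exact_mod_cast (Wd.torsionOrder_pos_holds).ne'
  have hcq : (Wd.tamagawaProduct : ℚ) ≠ 0 := by exact_mod_cast (Wd.tamagawaProduct_pos').ne'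
  have hid := varpi_mul_ratPlusSymbol_eq hGZK hXa.1 hf hϖ hq
  refine ⟨by rw [hid]; exact div_ne_zero (mul_ne_zero hq0 hcq) (pow_ne_zero 2 htq), ?_⟩
  have hc0 : padicValNat p Wd.tamagawaProduct = 0 := by
    refine padicValNat.eq_zero_of_not_dvd fun h => ?_
    obtain ⟨v, hv'⟩ := (Summit.BirchSwinnertonDyer.BirchSwinnertonDyer.Theorems.CornerLocal.NonSurjTwin.dvd_tamagawaProduct_iff_exists_split
      Wd p hXa hns hp5).mp h
    exact hnosplit v hv'
  have ht0 : padicValNat p Wd.torsionOrder = 0 := padicValNat_torsionOrder_eq_zero_of_irreducible Wd p hXa.2.2.2.1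
  rw [hid, padicValRat.div (mul_ne_zero hq0 hcq) (pow_ne_zero 2 htq), padicValRat.mul hq0 hcq, padicValRat.pow,
    hv, show (Wd.tamagawaProduct : ℚ) = ((Wd.tamagawaProduct : ℕ) : ℚ) by norm_cast, padicValRat.of_nat, hc0,
    show (Wd.torsionOrder : ℚ) = ((Wd.torsionOrder : ℕ) : ℚ) by norm_cast, padicValRat.of_nat, ht0]
  simp

end Summit.BirchSwinnertonDyer.Rank1Residual.X11b.MuAnUnit

namespace Summit.BirchSwinnertonDyer.BirchSwinnertonDyer.Theorems

open CongruenceSubgroup WeierstrassCurve Literature.NumberTheory.EllipticCurves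
  Literature.NumberTheory.EllipticCurves.ModularForms Literature.NumberTheory.EllipticCurves.Rank1Residual
  Summit.BirchSwinnertonDyer.Rank1Residual Summit.BirchSwinnertonDyer.Rank1Residual.X11b.MuAnUnit IsDedekindDomain

/-! ### §3 The analytic child's NON-split stub from `p ∤ #Ш_an` and «no split place» -/

/-- **`stub_twinMuAn_nonsplit` of 19948 `NonSurjCornerTwinMuAn` FROM BSD-INVARIANT DATA** — the registered stub text verbatim
(non-surjective X11a leaf twin `Wd`, `p ∈ {5,7}`, `p ∣ ord_p Δ_min`, NON-split at `p`, newform `f`, period ratio `ϖ`, MTT function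
`L` with `a = −1`) plus: GZK by name (`hGZK`), the analytic order of Ш as a rational `q ≠ 0` with `ord_p q = 0`, and «`Wd` has no
split multiplicative place». Then `[T⁰](ϖ·L) = 2ϖ·[0]⁺_f = 2·#Ш_an·∏c/#tors²` is a `p`-adic unit. Most frame binders are displayed
only so that the statement is the stub's text plus the named clauses. Nothing booked. [cite: Miller2011LMS, §1]
[cite: GreenbergLNM1716, §4 (PDF p. 113) and §1 Conj. 1.11 (shape)] [cite: MazurTateTeitelbaum1986, §I.10] -/
theorem nonSurjCornerTwinMuAn_nonsplit_of_shaAn_unit_of_forall_not_split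
    (hGZK : rank_eq_analyticRank_of_analyticRank_le_one) :
    ∀ (Wd : WeierstrassCurve ℚ) [Wd.IsElliptic] [Wd.IsGloballyMinimal] (p : ℕ) [Fact p.Prime],
      ClassX11a Wd p → ¬ Surj Wd p → (p = 5 ∨ p = 7) → p ∣ padicValInt p Wd.minimalDiscriminantInt →
      ¬ Wd.HasSplitMultiplicativeReductionAtPrime p →
      ∀ {N : ℕ} [NeZero N] (f : CuspForm (Gamma0 N) 2), IsNewformOf Wd f →
      ∀ (ϖ : ℚ), (ϖ : ℝ) * Wd.realPeriodRat = plusPeriod f →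
      ∀ (L : PowerSeries ℚ_[p]), IsMultPAdicLFunctionOf f p (-1) L →
        (∀ v : HeightOneSpectrum (𝓞 ℚ), ¬ Wd.HasSplitMultiplicativeReductionAt v) →
        ∀ (q : ℚ), shaAn Wd = (q : ℂ) → q ≠ 0 → padicValRat p q = 0 →
          ∃ n : ℕ, ‖PowerSeries.coeff n (PowerSeries.C ((ϖ : ℚ) : ℚ_[p]) * L)‖ = 1 := by
  intro Wd _ _ p _ hXa hns h57 _ _ N _ f hf ϖ hϖ L hL hnosplit q hq hq0 hv
  have hp5 : 5 ≤ p := by rcases h57 with rfl | rfl <;> norm_num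
  obtain ⟨hne, hval⟩ := padicValRat_varpi_mul_ratPlusSymbol_eq_zero hGZK hXa hns hp5 hnosplit hf hϖ hq hq0 hv
  exact exists_norm_coeff_eq_one_of_neg_one_of_padicValRat_eq_zero hXa.2.1 hL ϖ hne hval

end Summit.BirchSwinnertonDyer.BirchSwinnertonDyer.Theorems

end
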